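import Summits.AtomisticToContinuum.HydrodynamicLimit.Theorems.CollisionIsometryCLTMesoscopicLLNTreeBound

/-!
# `LocalGibbsFineScale` (route `BoxDissipativeWeakStrong`), file 1: L¹-normed tree bounds

Support lemmas for item stmt-AtomisticToContinuum-9905 (`LocalGibbsFineScale`: fine-scale law of
large numbers for canonical local Gibbs states of hard spheres at kinetic windows `ℓ_N → 0`,
`(N+1)ℓ_N³ → ∞`). The tree's cluster expansion (`HardCoreCanonical`, `HardSphereCanonicalTorus`,
`HardSphereEulerRatio`, `HardSphereEulerLLN`) bounds every decorated quantity by the SUP norm of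
the test function; the moving test function of the fine-scale statement,
`g_x = ℓ_N⁻³ 𝟙_{box(x, ℓ_N)}`, has sup norm `ℓ_N⁻³ → ∞` but unit `L¹` norm. This file re-derives the
bounds with the `L¹(μ)` norm of the function decorating the ROOT of the tree (the marked point),
directly from the integrated tree-graph inequality `lintegral_mul_aU_le` (which allows an arbitrary
weight at the root):

* `abs_integral_mul_mul_uR_le_integral` (abstract hard-core gas): the two-decoration version
  `|∫ g(x_i) h(x_j) u_B| ≤ ‖g‖_{L¹(ν)} C' t(#B) p^{#B-1}` of the one-decoration bound
  `MesoLLN.integral_abs_mul_abs_uR_le` (file `CollisionIsometryCLTMesoscopicLLNTreeBound`, item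
  stmt-AtomisticToContinuum-9524, which we reuse for `|W^g(k)|`, `|C(m,j)W^g_N(j+1)|`);
* `abs_sameBlockRem_le_L1`, `abs_sameBlockRem_div_le_L1` (torus, scale `ε_N`): the same-block
  remainder bounds of `HardSphereCanonicalTorus` / `HardSphereEulerLLN` with `C C' ↦ (∫ |g| dμ) C'`;
* `Md_le_integral_mul_Xi`, `onePt_le_two_mul` (Ruelle-type one-point bound): for `g ≥ 0`,
  `M^g(m) ≤ (∫ g dμ) Ξ(m-1)`, hence `E_{N+1-s}[g(x₀)] ≤ 2 ∫ g dμ` at small density.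
References: Pulvirenti–Tsagkarogiannis 2012 §4 (tree-graph bound); Ruelle 1969 §4.2.
-/

noncomputable section

namespace Summit.AtomisticToContinuum.HydrodynamicLimit.Theorems
namespace LGFS
open MeasureTheory ProbabilityTheory Finset Filter Topology
open Literature.Probability.LatticeModels Literature.MathematicalPhysics.StatisticalMechanics
  Literature.MathematicalPhysics.KineticTheory
open scoped ENNReal

/-! ### Abstract hard-core gas: tree bounds with an `L¹` weight at the root -/

section Abstract

variable {ι : Type*} [Fintype ι] [DecidableEq ι] {X : Type*} [MeasurableSpace X]
  {O : X → X → Prop} (ν : Measure X) [IsProbabilityMeasure ν]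

/-- **`L¹ × sup` tree bound with two decorations**: `|∫ g(x_i) h(x_j) u_B| ≤ (∫|g| dν) C' t(#B) p^{#B-1}`
for `i ∈ B`, `|h| ≤ C'`. -/
theorem abs_integral_mul_mul_uR_le_integral (hO : MeasurableSet {p : X × X | O p.1 p.2})
    (hOs : ∀ a b, O a b → O b a) {p : ℝ} (hp0 : 0 ≤ p)
    (hp : ∀ z, ν {y | O z y} ≤ ENNReal.ofReal p) {g h : X → ℝ} (hg : Measurable g)
    (hh : Measurable h) {C C' : ℝ} (hgC : ∀ y, |g y| ≤ C) (hhC : ∀ y, |h y| ≤ C') {i : ι} (j : ι)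
    {B : Finset ι} (hi : i ∈ B) :
    |∫ x, g (x i) * h (x j) * uR O x B ∂Measure.pi (fun _ : ι => ν)| ≤
      (∫ y, |g y| ∂ν) * C' * (treeNumber B.card * p ^ (B.card - 1)) := by
  set P := Measure.pi (fun _ : ι => ν) with hP
  have y0 : X := (Filter.nonempty_of_neBot (ae ν)).some
  have hC0 : 0 ≤ C := (abs_nonneg _).trans (hgC y0)
  have hC0' : 0 ≤ C' := (abs_nonneg _).trans (hhC y0)
  have hgi : Measurable fun x : ι → X => g (x i) := hg.comp (measurable_pi_apply i)
  have hhj : Measurable fun x : ι → X => h (x j) := hh.comp (measurable_pi_apply j)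
  have hint1 : Integrable (fun x : ι → X => |g (x i) * h (x j) * uR O x B|) P :=
    (integrable_pi_of_bounded ν (F := fun x => g (x i) * h (x j) * uR O x B)
      ((hgi.mul hhj).mul (measurable_uR hO B)) (C := C * C' * hcUrsellBound B) fun x => by
      rw [abs_mul, abs_mul]
      exact mul_le_mul (mul_le_mul (hgC _) (hhC _) (abs_nonneg _) hC0) (abs_uR_le x B)
        (abs_nonneg _) (mul_nonneg hC0 hC0')).abs
  have hint2 : Integrable (fun x : ι → X => C' * (|g (x i)| * |uR O x B|)) P :=
    (integrable_pi_of_bounded ν (F := fun x => |g (x i)| * |uR O x B|)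
      (hgi.abs.mul (measurable_uR hO B).abs)
      (C := C * hcUrsellBound B) fun x => by
        rw [abs_mul, abs_abs, abs_abs]
        exact mul_le_mul (hgC _) (abs_uR_le x B) (abs_nonneg _) hC0).const_mul C'
  calc |∫ x, g (x i) * h (x j) * uR O x B ∂P|
      ≤ ∫ x, |g (x i) * h (x j) * uR O x B| ∂P :=
        (Real.norm_eq_abs _).symm.trans_le ((norm_integral_le_integral_norm _).trans_eq
          (integral_congr_ae (ae_of_all _ fun x => Real.norm_eq_abs _)))
    _ ≤ ∫ x, C' * (|g (x i)| * |uR O x B|) ∂P := by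
        refine integral_mono hint1 hint2 fun x => ?_
        dsimp only
        rw [abs_mul, abs_mul]
        calc |g (x i)| * |h (x j)| * |uR O x B| ≤ |g (x i)| * C' * |uR O x B| := by
              gcongr; exact hhC _
          _ = C' * (|g (x i)| * |uR O x B|) := by ring
    _ ≤ C' * ((∫ y, |g y| ∂ν) * (treeNumber B.card * p ^ (B.card - 1))) := by
        rw [integral_const_mul]
        exact mul_le_mul_of_nonneg_left (MesoLLN.integral_abs_mul_abs_uR_le ν hO hOs hp0 hp hg hgC hi) hC0'
    _ = _ := by ring

end Abstract

/-! ### Size-form bounds on `𝕋³` with the `L¹(μ)` norm -/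

section Torus

variable {P : DensityProfile} {ε : ℝ} {n : ℕ}

/-- `0 ≤ ∫ |g| dμ`. -/
theorem integral_abs_nonneg (g : T3 → ℝ) : 0 ≤ ∫ y, |g y| ∂P.μ := integral_nonneg fun _ => abs_nonneg _

/-- **`L¹ × sup` bound on the same-block terms**:
`|same-block terms| ≤ (∫|g| dμ) C' ∑_{j < n-1} C(n-2, j) t(j+2) p_ε^{j+1} Ξ(n-2-j)`. -/
theorem abs_sameBlockRem_le_L1 [NeZero n] (h2 : 2 ≤ n) (hε : 0 ≤ ε) (hε2 : ε < 1 / 2)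
    {g h : T3 → ℝ} (hg : Measurable g) (hh : Measurable h) {C C' : ℝ} (hgC : ∀ y, |g y| ≤ C)
    (hhC : ∀ y, |h y| ≤ C') :
    |sameBlockRem P ε n h2 g h| ≤
      (∫ y, |g y| ∂P.μ) * C' * ∑ j ∈ range (n - 1), ((n - 2).choose j : ℝ) *
        (treeNumber (j + 2) * pOv P ε ^ (j + 1) * Xi P ε n (n - 2 - j)) := by
  set i₁ : Fin n := ⟨1, h2⟩ with hi₁
  have h01 : (0 : Fin n) ≠ i₁ := by simp [hi₁, Fin.ext_iff]
  unfold sameBlockRem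
  refine (abs_sum_le_sum_abs _ _).trans ?_
  have hterm : ∀ B ∈ ((univ : Finset (Fin n)).powerset.filter (fun B => (0 : Fin n) ∈ B)).filter
      (fun B => i₁ ∈ B),
      |(∫ x, g (x 0) * h (x i₁) * uR (Ov ε) x B ∂Measure.pi (fun _ : Fin n => P.μ)) *
          hcProb (Ov ε) P.μ (univ \ B)| ≤
        (∫ y, |g y| ∂P.μ) * C' *
          (treeNumber B.card * pOv P ε ^ (B.card - 1) * Xi P ε n (n - B.card)) := by
    intro B hB
    simp only [mem_filter] at hB
    have hXi : hcProb (Ov ε) P.μ (univ \ B) = Xi P ε n (n - B.card) := by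
      refine hcProb_eq_of_card_eq P.μ (measurableSet_ov ε) ?_
      rw [card_sdiff_of_subset (subset_univ B), card_univ, Fintype.card_fin,
        card_firstLabels (by omega)]
    rw [abs_mul, hXi, abs_of_nonneg (Xi_nonneg _)]
    calc |∫ x, g (x 0) * h (x i₁) * uR (Ov ε) x B ∂Measure.pi (fun _ : Fin n => P.μ)| *
          Xi P ε n (n - B.card)
        ≤ ((∫ y, |g y| ∂P.μ) * C' * (treeNumber B.card * pOv P ε ^ (B.card - 1))) *
            Xi P ε n (n - B.card) :=
          mul_le_mul_of_nonneg_right (abs_integral_mul_mul_uR_le_integral P.μ (measurableSet_ov ε)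
            (ov_symm ε) (pOv_nonneg P hε) (μ_ov_le_pOv P hε hε2) hg hh hgC hhC i₁ hB.1.2)
            (Xi_nonneg _)
      _ = _ := by ring
  refine (sum_le_sum hterm).trans (le_of_eq ?_)
  rw [sum_filter_mem_mem_card univ (mem_univ 0) (mem_univ i₁) h01
    (fun k => (∫ y, |g y| ∂P.μ) * C' * (treeNumber k * pOv P ε ^ (k - 1) * Xi P ε n (n - k))),
    card_univ, Fintype.card_fin, mul_sum]
  refine sum_congr rfl fun j _ => ?_
  rw [nsmul_eq_mul, show j + 2 - 1 = j + 1 by omega, show n - (j + 2) = n - 2 - j by omega]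
  ring

/-- **The same-block remainder over the partition function, `L¹ × sup` form**: at small density,
`|same-block(g, h)| / Ξ_N(N+1) ≤ 4 e² (∫|g| dμ) C' S p_{ε_N}` with
`S = θ/(1-θ)² + (1-θ)⁻¹` (it carries the extra factor `p_{ε_N} = λ/(N+1)`). -/
theorem abs_sameBlockRem_div_le_L1 {σ : ℝ} (hs : SmallDensity P σ) {g h : T3 → ℝ}
    (hg : Measurable g) (hh : Measurable h) {C C' : ℝ} (hgC : ∀ y, |g y| ≤ C)
    (hhC : ∀ y, |h y| ≤ C') (N : ℕ) (h2 : 2 ≤ N + 1) :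
    |sameBlockRem P (hsDiameter σ N) (N + 1) h2 g h / XiN P σ N (N + 1)| ≤
      4 * Real.exp 1 ^ 2 * ((∫ y, |g y| ∂P.μ) * C') *
        (geomRatio P σ / (1 - geomRatio P σ) ^ 2 + (1 - geomRatio P σ)⁻¹) *
        pOv P (hsDiameter σ N) := by
  have hlam1 := hs.ovDensity_lt_one
  have hθ0 := hs.geomRatio_nonneg
  have hl0 := hs.ovDensity_nonneg
  have hI : 0 ≤ ∫ y, |g y| ∂P.μ := integral_abs_nonneg g
  have hC' : 0 ≤ C' := (abs_nonneg _).trans (hhC 0)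
  set S := geomRatio P σ / (1 - geomRatio P σ) ^ 2 + (1 - geomRatio P σ)⁻¹ with hS
  have hε0 := hsDiameter_nonneg' (σ := σ) hs.σ_pos.le N
  have hε2 := hsDiameter_lt_half hs.σ_pos.le hs.σ_lt_half N
  have hp0 : 0 ≤ pOv P (hsDiameter σ N) := pOv_nonneg P hε0
  have hXi := XiN_pos hs.σ_pos.le hs.σ_lt_half hlam1 (N := N) (m := N + 1) le_rfl
  have hrem := abs_sameBlockRem_le_L1 (P := P) (n := N + 1) h2 hε0 hε2 hg hh hgC hhC
  rw [abs_div, abs_of_pos hXi, div_le_iff₀ hXi]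
  refine hrem.trans ?_
  rw [mul_sum]
  have hterm : ∀ j ∈ range (N + 1 - 1), (∫ y, |g y| ∂P.μ) * C' * (((N + 1 - 2).choose j : ℝ) *
      (treeNumber (j + 2) * pOv P (hsDiameter σ N) ^ (j + 1) *
        Xi P (hsDiameter σ N) (N + 1) (N + 1 - 2 - j))) ≤
      (4 * Real.exp 1 ^ 2 * ((∫ y, |g y| ∂P.μ) * C') * pOv P (hsDiameter σ N) * XiN P σ N (N + 1)) *
        (((j : ℝ) + 1) * geomRatio P σ ^ j) := by
    intro j hj
    have hj' : j < N := by have := mem_range.mp hj; omega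
    have hratio : Xi P (hsDiameter σ N) (N + 1) (N + 1 - 2 - j) =
        rN P σ N (N + 1) (j + 2) * XiN P σ N (N + 1) := by
      rw [rN, div_mul_cancel₀ _ hXi.ne', XiN, show N + 1 - (j + 2) = N + 1 - 2 - j by omega]
    have hr0 : 0 ≤ rN P σ N (N + 1) (j + 2) :=
      zero_le_one.trans (one_le_rN hs.σ_pos.le hs.σ_lt_half hlam1 le_rfl (by omega))
    have hr2 := hs.rN_le_two_pow (N := N) (m := N + 1) (j := j + 2) le_rfl (by omega)
    have hchoose : ((N + 1 - 2).choose j : ℝ) ≤ ((N + 1 - 2 : ℕ) : ℝ) ^ j / j.factorial :=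
      Nat.choose_le_pow_div j (N + 1 - 2)
    have hmp : ((N + 1 - 2 : ℕ) : ℝ) * pOv P (hsDiameter σ N) ≤ ovDensity P σ :=
      mul_pOv_le_ovDensity hs.σ_pos.le (by omega)
    have htree := treeNumber_succ_succ_mul_pow_div_factorial_le hl0 j
    have hmain : ((N + 1 - 2).choose j : ℝ) *
        (treeNumber (j + 2) * pOv P (hsDiameter σ N) ^ (j + 1)) ≤
        Real.exp 1 ^ 2 * (j + 1) * (Real.exp 1 * ovDensity P σ) ^ j * pOv P (hsDiameter σ N) := by
      calc ((N + 1 - 2).choose j : ℝ) * (treeNumber (j + 2) * pOv P (hsDiameter σ N) ^ (j + 1))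
          ≤ (((N + 1 - 2 : ℕ) : ℝ) ^ j / j.factorial) *
              (treeNumber (j + 2) * pOv P (hsDiameter σ N) ^ (j + 1)) :=
            mul_le_mul_of_nonneg_right hchoose (by positivity)
        _ = (treeNumber (j + 2) * (((N + 1 - 2 : ℕ) : ℝ) * pOv P (hsDiameter σ N)) ^ j / j.factorial) *
              pOv P (hsDiameter σ N) := by rw [mul_pow]; ring
        _ ≤ (treeNumber (j + 2) * ovDensity P σ ^ j / j.factorial) * pOv P (hsDiameter σ N) := by
            gcongr
        _ ≤ Real.exp 1 ^ 2 * (j + 1) * (Real.exp 1 * ovDensity P σ) ^ j * pOv P (hsDiameter σ N) :=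
            mul_le_mul_of_nonneg_right htree hp0
    rw [hratio]
    have hIC : 0 ≤ (∫ y, |g y| ∂P.μ) * C' := mul_nonneg hI hC'
    calc (∫ y, |g y| ∂P.μ) * C' * (((N + 1 - 2).choose j : ℝ) * (treeNumber (j + 2) *
          pOv P (hsDiameter σ N) ^ (j + 1) * (rN P σ N (N + 1) (j + 2) * XiN P σ N (N + 1))))
        = (∫ y, |g y| ∂P.μ) * C' * ((((N + 1 - 2).choose j : ℝ) * (treeNumber (j + 2) *
            pOv P (hsDiameter σ N) ^ (j + 1))) * rN P σ N (N + 1) (j + 2)) * XiN P σ N (N + 1) := by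
          ring
      _ ≤ (∫ y, |g y| ∂P.μ) * C' * ((Real.exp 1 ^ 2 * (j + 1) * (Real.exp 1 * ovDensity P σ) ^ j *
            pOv P (hsDiameter σ N)) * 2 ^ (j + 2)) * XiN P σ N (N + 1) := by
          have hin := mul_le_mul hmain hr2 hr0 (by positivity)
          exact mul_le_mul_of_nonneg_right (mul_le_mul_of_nonneg_left hin hIC) hXi.le
      _ = (4 * Real.exp 1 ^ 2 * ((∫ y, |g y| ∂P.μ) * C') * pOv P (hsDiameter σ N) *
            XiN P σ N (N + 1)) * (((j : ℝ) + 1) * geomRatio P σ ^ j) := by rw [geomRatio]; ring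
  refine (sum_le_sum hterm).trans ?_
  rw [← mul_sum]
  have hS0 : ∀ j : ℕ, 0 ≤ ((j : ℝ) + 1) * geomRatio P σ ^ j := fun j =>
    mul_nonneg (by positivity) (pow_nonneg hθ0 j)
  have hpart : ∑ j ∈ range (N + 1 - 1), ((j : ℝ) + 1) * geomRatio P σ ^ j ≤ S :=
    sum_le_hasSum _ (fun j _ => hS0 j) hs.hasSum_succ_mul_geomRatio_pow
  calc (4 * Real.exp 1 ^ 2 * ((∫ y, |g y| ∂P.μ) * C') * pOv P (hsDiameter σ N) * XiN P σ N (N + 1)) *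
        ∑ j ∈ range (N + 1 - 1), ((j : ℝ) + 1) * geomRatio P σ ^ j
      ≤ (4 * Real.exp 1 ^ 2 * ((∫ y, |g y| ∂P.μ) * C') * pOv P (hsDiameter σ N) * XiN P σ N (N + 1)) * S :=
        mul_le_mul_of_nonneg_left hpart (by positivity)
    _ = _ := by ring

/-! ### Ruelle-type one-point bound -/

/-- The hard-core indicator is antitone in the set of labels. -/
theorem efR_le_efR_of_subset {W W' : Finset (Fin n)} (hW : W' ⊆ W) (x : Fin n → T3) :
    efR (Ov ε) x W ≤ efR (Ov ε) x W' := by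
  rw [efR_eq_indicator, efR_eq_indicator]
  by_cases hx : x ∈ hardCoreSet (Ov ε) W
  · have hx' : x ∈ hardCoreSet (Ov ε) W' := fun i hi j hj hij => hx i (hW hi) j (hW hj) hij
    rw [Set.indicator_of_mem hx, Set.indicator_of_mem hx']
  · rw [Set.indicator_of_notMem hx]
    exact Set.indicator_nonneg (fun _ _ => zero_le_one) _

/-- `M^{c g}(m) = c M^g(m)`. -/
theorem Md_const_mul [NeZero n] (c : ℝ) (g : T3 → ℝ) (m : ℕ) :
    Md P ε n (fun y => c * g y) m = c * Md P ε n g m := by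
  rw [Md, Md, decPF, decPF, ← integral_const_mul]
  refine integral_congr_ae (ae_of_all _ fun x => ?_)
  ring

/-- `0 ≤ M^g(m)` for `g ≥ 0`. -/
theorem Md_nonneg [NeZero n] {g : T3 → ℝ} (hg0 : ∀ y, 0 ≤ g y) (m : ℕ) : 0 ≤ Md P ε n g m :=
  integral_nonneg fun x => mul_nonneg (hg0 _) (efR_nonneg x _)

/-- **Ruelle's one-point bound**: for `g ≥ 0` and `1 ≤ m ≤ n`, `M^g(m) ≤ (∫ g dμ) Ξ(m-1)` — drop the
hard-core constraints involving the marked particle and integrate it out. -/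
theorem Md_le_integral_mul_Xi [NeZero n] {g : T3 → ℝ} (hg : Measurable g) {C : ℝ}
    (hgC : ∀ y, |g y| ≤ C) (hg0 : ∀ y, 0 ≤ g y) {m : ℕ} (hm1 : 1 ≤ m) (hmn : m ≤ n) :
    Md P ε n g m ≤ (∫ y, g y ∂P.μ) * Xi P ε n (m - 1) := by
  set W := firstLabels n m with hW
  set W' := W.erase 0 with hW'
  have h0 : (0 : Fin n) ∈ W := zero_mem_firstLabels hm1
  have hO := measurableSet_ov ε
  have hg0m : Measurable fun x : Fin n → T3 => g (x 0) := hg.comp (measurable_pi_apply 0)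
  have hint : ∀ V : Finset (Fin n),
      Integrable (fun x => g (x 0) * efR (Ov ε) x V) (Measure.pi fun _ : Fin n => P.μ) := fun V =>
    integrable_pi_of_bounded P.μ (hg0m.mul (measurable_efR hO V)) (C := C * 1) fun x => by
      rw [abs_mul]
      exact mul_le_mul (hgC _) (abs_efR_le_one x _) (abs_nonneg _) ((abs_nonneg _).trans (hgC (x 0)))
  -- pointwise domination
  have hle : Md P ε n g m ≤ ∫ x, g (x 0) * efR (Ov ε) x W' ∂Measure.pi (fun _ : Fin n => P.μ) := by
    rw [Md, decPF]
    refine integral_mono (hint W) (hint W') fun x => ?_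
    exact mul_le_mul_of_nonneg_left (efR_le_efR_of_subset (erase_subset 0 W) x) (hg0 _)
  refine hle.trans (le_of_eq ?_)
  -- factorisation over the disjoint label sets `{0}` and `W'`
  have hdisj : Disjoint ({0} : Finset (Fin n)) W' := by
    rw [disjoint_singleton_left]; exact notMem_erase 0 W
  have hdepF : DependsOn (fun x : Fin n → T3 => g (x 0)) (({0} : Finset (Fin n)) : Set (Fin n)) := by
    intro x y hxy; exact congrArg g (hxy 0 (by simp))
  rw [integral_mul_eq_of_dependsOn P.μ hdisj hg0m (measurable_efR hO W') hdepF (dependsOn_efR W'),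
    integral_efR P.μ hO]
  congr 1
  · have hmp := measurePreserving_eval (fun _ : Fin n => P.μ) (0 : Fin n)
    conv_rhs => rw [← hmp.map_eq]
    rw [integral_map (measurable_pi_apply 0).aemeasurable]
    rw [hmp.map_eq]; exact hg.aestronglyMeasurable
  · rw [Xi]
    refine hcProb_eq_of_card_eq P.μ hO ?_
    rw [hW', card_erase_of_mem h0, hW, card_firstLabels hmn, card_firstLabels (by omega)]

/-- **`E_{N+1-s}[g(x₀)] ≤ 2 ∫ g dμ`** for `g ≥ 0` bounded measurable and `s ≤ N` at small density
(Ruelle's bound and `Ξ(m-1)/Ξ(m) ≤ 2`). -/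
theorem onePt_le_two_mul {σ : ℝ} (hs : SmallDensity P σ) {g : T3 → ℝ} (hg : Measurable g) {C : ℝ}
    (hgC : ∀ y, |g y| ≤ C) (hg0 : ∀ y, 0 ≤ g y) {N s : ℕ} (hsN : s ≤ N) :
    onePt P σ g N s ≤ 2 * ∫ y, g y ∂P.μ := by
  have hlam1 := hs.ovDensity_lt_one
  have hXi := XiN_pos hs.σ_pos.le hs.σ_lt_half hlam1 (N := N) (m := N + 1 - s) (Nat.sub_le _ _)
  have hMd := Md_le_integral_mul_Xi (P := P) (ε := hsDiameter σ N) (n := N + 1) hg hgC hg0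
    (m := N + 1 - s) (by omega) (Nat.sub_le _ _)
  have hq := hs.qN_le_two (N := N) (m := N - s) (Nat.sub_le _ _)
  rw [qN, div_le_iff₀ (XiN_pos hs.σ_pos.le hs.σ_lt_half hlam1 (N := N) (m := N - s + 1) (by omega))]
    at hq
  have h1 : Xi P (hsDiameter σ N) (N + 1) (N + 1 - s - 1) = XiN P σ N (N - s) := by
    rw [XiN, show N + 1 - s - 1 = N - s by omega]
  have h2 : XiN P σ N (N - s + 1) = XiN P σ N (N + 1 - s) := by
    rw [show N - s + 1 = N + 1 - s by omega]
  rw [h1] at hMd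
  rw [h2] at hq
  have hI : 0 ≤ ∫ y, g y ∂P.μ := integral_nonneg hg0
  rw [onePt, div_le_iff₀ hXi]
  calc Md P (hsDiameter σ N) (N + 1) g (N + 1 - s) ≤ (∫ y, g y ∂P.μ) * XiN P σ N (N - s) := hMd
    _ ≤ (∫ y, g y ∂P.μ) * (2 * XiN P σ N (N + 1 - s)) := mul_le_mul_of_nonneg_left hq hI
    _ = 2 * (∫ y, g y ∂P.μ) * XiN P σ N (N + 1 - s) := by ring

end Torus

end LGFS
end Summit.AtomisticToContinuum.HydrodynamicLimit.Theorems
end
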